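import Mathlib
import HarnessLib
import Literature.Analysis.FluidPDE.SuitableWeak
import Literature.Analysis.FluidPDE.MildSolution
import Summits.NavierStokesRegularity.NavierStokesRegularity.Theses.AngularGalerkinLadder

/-! # BC3 skeleton (birth line, v2y = v2x + t ≥ 0 cutoff clause (gen-2 children, route rev 4)) for crux `LimitTransfer`
(item stmt-NavierStokesRegularity-19961, route `route-NavierStokesRegularity-AngularGalerkinLadder`, card K3)

v2 (planner ns-blowup-plan g20, 2026-08-26): the pre-birth stub set (`HOME/plan/agl/bc/LimitTransfer_birth.lean`,
sha16 d2d283552039b74f, evidence #1 on the item) re-cut to IMPORT the born route module and to conclude the crux BY NAME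
(`…Theses.AngularGalerkinLadder.LimitTransfer`). Stubs: `stub_local_compactness` (L: Type-I bounded classical rung
solutions with defects ε_n → 0 are precompact in C_loc with pressures; limits solve UNFORCED NS classically) and
`stub_structure_passes` (M: rotated-DSS structure, Type-I, nontriviality, measurability, ancient-mild pass to the limit).
Sorries ONLY inside `stub_*`. WHAT THIS IS NOT: not NS — a registered plan. -/

set_option linter.dupNamespace false

namespace Summit.NavierStokesRegularity.NavierStokesRegularity.Cruxes.LimitTransfer.Birth

open scoped Topology
open Filter Set MeasureTheory
open Summit.NavierStokesRegularity.FluidComputer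

local notation "ℝ³" => EuclideanSpace ℝ (Fin 3)

/-- The crux, by name, behind a local abbreviation: the composition theorem `LimitTransfer_of` (explicit stub-signature
hypotheses, BC3 shape) concludes `Goal`, so that the ONLY theorem of this file concluding the crux constant by name is the
hypothesis-free `LimitTransfer_skeleton` — the A12 skeleton audit (`#h21_check_skeleton`) takes the first such theorem and
refuses Prop hypotheses that are not registered obligations (v2x, planner g20, after the operator's 22:10Z registration attempt failed `skeleton.extra-hypothesis`). -/
abbrev Goal : Prop := Summit.NavierStokesRegularity.NavierStokesRegularity.Theses.AngularGalerkinLadder.LimitTransfer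

/-- A WINDOW SEQUENCE: the hypothesis package of K3. -/
def IsWindowSequence (C₀ cmin cmax δ : ℝ) (L : ℕ → ℕ) (ε c : ℕ → ℝ) (R : ℕ → (ℝ³ ≃ₗᵢ[ℝ] ℝ³))
    (u : ℕ → ℝ → ℝ³ → ℝ³) (p : ℕ → ℝ → ℝ³ → ℝ) (d : ℕ → ℝ → ℝ³ → ℝ³) : Prop :=
  1 < cmin ∧ 0 < δ ∧ Tendsto ε atTop (𝓝 0) ∧
    ∀ n, AngularLadder.IsWindowProfile (L n) C₀ cmin cmax δ (ε n) (c n) (R n) (u n) (p n) (d n)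

/-- A LADDER LIMIT along the subsequence `φ`: factors and rotations converge, the velocities converge
locally uniformly on every slice, and the limit `(v, q)` is a classical UNFORCED Navier–Stokes
solution on `(−∞, 0)` (ν = 1) with the Type-I bound `C₀`, pressure bounded on every past slab, and `v` CUT OFF
to zero on `t ≥ 0` (ns-blowup-lit g13 K-NOTE: `IsRotatedDSS` quantifies over all `t`). -/
def IsLadderLimit (C₀ : ℝ) (c : ℕ → ℝ) (R : ℕ → (ℝ³ ≃ₗᵢ[ℝ] ℝ³)) (u : ℕ → ℝ → ℝ³ → ℝ³)
    (φ : ℕ → ℕ) (c' : ℝ) (R' : ℝ³ ≃ₗᵢ[ℝ] ℝ³) (v : ℝ → ℝ³ → ℝ³) (q : ℝ → ℝ³ → ℝ) : Prop :=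
  StrictMono φ ∧ Tendsto (fun n => c (φ n)) atTop (𝓝 c') ∧
    (∀ x, Tendsto (fun n => R (φ n) x) atTop (𝓝 (R' x))) ∧
    (∀ t < 0, TendstoLocallyUniformly (fun n => u (φ n) t) (v t) atTop) ∧
    Literature.Analysis.FluidPDE.IsClassicalNSSolutionOn (Set.Iio 0) 1 0 v q ∧
    Literature.Analysis.FluidPDE.HasTypeIDecay C₀ v ∧ (∀ t, 0 ≤ t → v t = 0) ∧
    ∀ t < 0, Literature.Analysis.FluidPDE.IsBoundedOn (Set.Iic t) q

/-- stub 1 (L): LOCAL COMPACTNESS — Type-I bounded classical rung solutions with defects `ε_n → 0`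
are precompact in `C_loc` with their pressures, and limits solve UNFORCED Navier–Stokes classically
(interior parabolic regularity uniform in the rung: `Π_L` commutes with `Δ` and the Leray projection). -/
theorem stub_local_compactness :
    ∀ (C₀ cmin cmax δ : ℝ) (L : ℕ → ℕ) (ε c : ℕ → ℝ) (R : ℕ → (ℝ³ ≃ₗᵢ[ℝ] ℝ³))
      (u : ℕ → ℝ → ℝ³ → ℝ³) (p : ℕ → ℝ → ℝ³ → ℝ) (d : ℕ → ℝ → ℝ³ → ℝ³),
      IsWindowSequence C₀ cmin cmax δ L ε c R u p d →
        ∃ (φ : ℕ → ℕ) (c' : ℝ) (R' : ℝ³ ≃ₗᵢ[ℝ] ℝ³) (v : ℝ → ℝ³ → ℝ³) (q : ℝ → ℝ³ → ℝ),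
          IsLadderLimit C₀ c R u φ c' R' v q := by
  sorry

/-- stub 2 (M): STRUCTURE PASSES TO THE LIMIT — along a ladder limit of a window sequence the limit is
rotated-DSS with the limit factor/rotation (c' ∈ [cmin, cmax] so c' > 1), Type-I, nontrivial (the
amplitude floor δ at t = −1 sits at radius ≤ C₀/δ − 1 and survives locally uniform convergence),
slice-measurable (continuous) and ancient mild (`Theorems.isAncientMildSolution_of_classical_Iio`). -/
theorem stub_structure_passes :
    ∀ (C₀ cmin cmax δ : ℝ) (L : ℕ → ℕ) (ε c : ℕ → ℝ) (R : ℕ → (ℝ³ ≃ₗᵢ[ℝ] ℝ³))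
      (u : ℕ → ℝ → ℝ³ → ℝ³) (p : ℕ → ℝ → ℝ³ → ℝ) (d : ℕ → ℝ → ℝ³ → ℝ³)
      (φ : ℕ → ℕ) (c' : ℝ) (R' : ℝ³ ≃ₗᵢ[ℝ] ℝ³) (v : ℝ → ℝ³ → ℝ³) (q : ℝ → ℝ³ → ℝ),
      IsWindowSequence C₀ cmin cmax δ L ε c R u p d → IsLadderLimit C₀ c R u φ c' R' v q →
        1 < c' ∧ Literature.Analysis.FluidPDE.IsAncientMildSolution 1 v ∧
          (∀ t < 0, AEStronglyMeasurable (v t) volume) ∧ Literature.Analysis.FluidPDE.IsRotatedDSS c' R' v ∧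
          (∃ C : ℝ, Literature.Analysis.FluidPDE.HasTypeIDecay C v) ∧ ¬ (∀ t < 0, v t =ᵐ[volume] 0) := by
  sorry

/-- The crux BY NAME from the two stubs (real proof). -/
theorem LimitTransfer_of
    (h1 : ∀ (C₀ cmin cmax δ : ℝ) (L : ℕ → ℕ) (ε c : ℕ → ℝ) (R : ℕ → (ℝ³ ≃ₗᵢ[ℝ] ℝ³))
      (u : ℕ → ℝ → ℝ³ → ℝ³) (p : ℕ → ℝ → ℝ³ → ℝ) (d : ℕ → ℝ → ℝ³ → ℝ³),
      IsWindowSequence C₀ cmin cmax δ L ε c R u p d →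
        ∃ (φ : ℕ → ℕ) (c' : ℝ) (R' : ℝ³ ≃ₗᵢ[ℝ] ℝ³) (v : ℝ → ℝ³ → ℝ³) (q : ℝ → ℝ³ → ℝ),
          IsLadderLimit C₀ c R u φ c' R' v q)
    (h2 : ∀ (C₀ cmin cmax δ : ℝ) (L : ℕ → ℕ) (ε c : ℕ → ℝ) (R : ℕ → (ℝ³ ≃ₗᵢ[ℝ] ℝ³))
      (u : ℕ → ℝ → ℝ³ → ℝ³) (p : ℕ → ℝ → ℝ³ → ℝ) (d : ℕ → ℝ → ℝ³ → ℝ³)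
      (φ : ℕ → ℕ) (c' : ℝ) (R' : ℝ³ ≃ₗᵢ[ℝ] ℝ³) (v : ℝ → ℝ³ → ℝ³) (q : ℝ → ℝ³ → ℝ),
      IsWindowSequence C₀ cmin cmax δ L ε c R u p d → IsLadderLimit C₀ c R u φ c' R' v q →
        1 < c' ∧ Literature.Analysis.FluidPDE.IsAncientMildSolution 1 v ∧
          (∀ t < 0, AEStronglyMeasurable (v t) volume) ∧ Literature.Analysis.FluidPDE.IsRotatedDSS c' R' v ∧
          (∃ C : ℝ, Literature.Analysis.FluidPDE.HasTypeIDecay C v) ∧ ¬ (∀ t < 0, v t =ᵐ[volume] 0)) : Goal := by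
  show Summit.NavierStokesRegularity.NavierStokesRegularity.Theses.AngularGalerkinLadder.LimitTransfer
  intro C₀ cmin cmax δ L ε c R u p d hcmin hδ hε hW
  have hseq : IsWindowSequence C₀ cmin cmax δ L ε c R u p d := ⟨hcmin, hδ, hε, hW⟩
  obtain ⟨φ, c', R', v, q, hlim⟩ := h1 C₀ cmin cmax δ L ε c R u p d hseq
  exact ⟨c', R', v, h2 C₀ cmin cmax δ L ε c R u p d φ c' R' v q hseq hlim⟩

/-- The hypothesis-free skeleton line: carries the stubs' `sorry`s — decoration, not closure. -/
theorem LimitTransfer_skeleton :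
    Summit.NavierStokesRegularity.NavierStokesRegularity.Theses.AngularGalerkinLadder.LimitTransfer :=
  LimitTransfer_of stub_local_compactness stub_structure_passes

end Summit.NavierStokesRegularity.NavierStokesRegularity.Cruxes.LimitTransfer.Birth
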